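import Literature.AlgebraicGeometry.HodgeTheory.InvariantClassesFromTotalSpaceHolds
import Literature.AlgebraicGeometry.HodgeTheory.DirectImageBaseChangeSections
import Literature.AlgebraicGeometry.HodgeTheory.AndreottiFrankelHomotopyType
import Literature.AlgebraicTopology.Homotopy.SerreFibrationInvariantCyclesDimOne
import HarnessLib

/-!
# Invariant classes come from the total space over a smooth affine CURVE, for every smooth proper family (no projectivity, no Hodge theory)

Family `hodge`, layer `Literature/AlgebraicGeometry/HodgeTheory`. PROOF FILE (theorems only; no
definition, no named fact). Companion of `InvariantClassesFromTotalSpaceHolds` (Voisin II Thm. 4.18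
for total spaces immersed in `ℙᵐ`) and `InvariantClassesFromTotalSpaceLefschetzClass` (the same for
a class with the Lefschetz condition on one fibre). Here the base does the work instead of the
total space: over a smooth AFFINE CURVE `S`, Deligne's theorem "`Hᵏ(X; ℚ) → H⁰(S, Rᵏ f_* ℚ)` is
surjective" holds for EVERY proper submersion, because the Leray spectral sequence has only the
columns `p = 0, 1` — `S(ℂ)` is a non-compact Riemann surface, of the homotopy type of a
`1`-dimensional CW complex (Andreotti–Frankel 1959 / Milnor 1963 Thm. 7.2 for the smooth affine
curve `S`: `S(ℂ)` is exhausted by compact sublevel sets of a proper Morse function of index `≤ 1`,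
each homotopy equivalent to a finite CW complex without cells of dimension `> 1`; the tree's
`AffineCoordinates.exists_sublevels_homotopyEquiv_cwComplex_of_isAffine` with `k = 0`) — so no
differential `d_r`, `r ≥ 2`, can be non-zero and no Lefschetz class is needed (the topological
theorem `SerreInvariantCycles.exists_class_of_flat_of_exhaustion`).

* `invariantCycles_of_affineCurveBase` — **Voisin II Thm. 4.18 (`ℚ`-statement) for a smooth proper
  family `f : 𝒳 ⟶ S` with smooth projective fibres (`Motives.IsSmoothProjectiveFamily f n₀`) over a
  smooth affine curve `S` (`IsAffine`, `SmoothOfRelativeDimension 1`)**: every flat section of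
  `Rᵏ f(ℂ)_* ℚ` is the family of restrictions of one class of `Hᵏ(𝒳(ℂ); ℚ)`. NO projectivity of `f`,
  NO quasi-projectivity of `𝒳`, no Lefschetz class, no Hodge theory.
* `invariantClass_fromTotalSpace_of_affineCurveBase` — the consequence on the `ℂ`-carriers of
  `HodgeLocus` (the sentence of the named fact `deligne1971_invariantClass_fromTotalSpace_proper`,
  Deligne *Hodge II* Thm. 4.1.1 (i), for THESE families): every value `σ(s₀)` of a continuous
  section `σ` of `FiberClass.pt` is `globalSection f k β s₀` for some `β ∈ Hᵏ(𝒳(ℂ); ℂ)` (flat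
  coordinate `ℚ`-sections and universal coefficients, verbatim the reduction of
  `deligne1968_invariantClass_fromTotalSpace_holds`).

This is the case of Deligne's partie fixe for PROPER smooth morphisms (Hodge II, Thm. 4.1.1 (i))
over curves, proved without Hodge II; since the flat-section form of the variational Hodge
conjecture is local on the base and reduces to smooth affine curve bases (Mumford's lemma), it is
what that reduction consumes (Hodge summit, Ring 2, row b04).

## References

* [VoisinHodgeII2003] C. Voisin, Hodge Theory and Complex Algebraic Geometry II (CUP 2003), §1.2.2
  Thm. 1.22, §4.2.3–4.3.1, Lemma 4.17, Thm. 4.18.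
* [Milnor1963] J. Milnor, Morse theory, Ann. of Math. Studies 51 (1963), Thm. 3.5, §7 Thm. 7.2.
* [AndreottiFrankel1959] A. Andreotti, T. Frankel, The Lefschetz theorem on hyperplane sections,
  Ann. of Math. 69 (1959), 713–717.
* [DeligneHodgeII1971] P. Deligne, Théorie de Hodge II, Publ. Math. IHÉS 40 (1971), Thm. 4.1.1 (i).
* [HatcherAT2002] A. Hatcher, Algebraic Topology (CUP 2002), §3.1 Thm. 3.2, Prop. 3.33, §3.A Cor. 3A.4.
-/

noncomputable section

open CategoryTheory AlgebraicGeometry Filter TopologicalSpace Set Function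
open scoped Manifold ContDiff Topology
open Literature.AlgebraicTopology.SingularHomology
open Literature.AlgebraicTopology.Homotopy
open Literature.Algebra.Homology Literature.Geometry.Kaehler

namespace Literature.AlgebraicGeometry.HodgeTheory

open _root_.Topology
open Literature.AlgebraicGeometry.Motives

universe u

section Family

variable {𝒳 S : Motives.SchemeOver ℂ} (f : 𝒳 ⟶ S)

/-- **Deligne's invariant cycle theorem (Voisin II, Thm. 4.18, `ℚ`-statement) over a smooth affine
curve, for every smooth proper family.** Let `f : 𝒳 ⟶ S` be a smooth proper family of relative
dimension `n₀` with smooth projective fibres (`IsSmoothProjectiveFamily f n₀`) over a smooth affine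
curve `S` (`IsAffine S`, `SmoothOfRelativeDimension 1 S.hom`). Then every flat section `y` of
`Rᵏ f(ℂ)_* ℚ` is the family of restrictions of one class `z ∈ Hᵏ(𝒳(ℂ); ℚ)`. Proof: `f(ℂ)` is a Serre
fibration (Ehresmann); `S(ℂ)` is exhausted by the open sublevel sets `{φ < m}` of the proper Morse
function of Andreotti–Frankel, inside compact sublevel sets `{φ ≤ a_m}` homotopy equivalent to
finite CW complexes without cells of dimension `> 1` (Milnor Thm. 7.2 / Voisin II Thm. 1.22 for the
curve `S`); over such a base flat families extend with no Lefschetz class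
(`SerreInvariantCycles.exists_class_of_flat_of_exhaustion`: the Leray spectral sequence has two
columns). NO projectivity of `f` or of `𝒳` is assumed.
[cite: VoisinHodgeII2003, Thm. 4.18 with Lemma 4.17 and §1.2.2 Thm. 1.22]
[cite: Milnor1963, §7 Thm. 7.2] [cite: DeligneHodgeII1971, Théorème 4.1.1 (i)] -/
theorem invariantCycles_of_affineCurveBase {n₀ : ℕ} (hf : IsSmoothProjectiveFamily f n₀)
    [IsAffine S.left] [SmoothOfRelativeDimension 1 S.hom] (k : ℕ)
    (y : ∀ s : Motives.ComplexPoints S, Motives.bettiCohomology (Motives.fiberOver f s) k)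
    (hy : Motives.IsFlatSection f k y) :
    ∃ z : Motives.bettiCohomology 𝒳 k,
      ∀ s, (Motives.bettiCohomology.map (Motives.fiberι f s) k).hom z = y s := by
  classical
  haveI : IsProper f.left := hf.isProper
  haveI : Smooth f.left := hf.smooth
  haveI : Smooth S.hom := SmoothOfRelativeDimension.smooth 1 _
  haveI : LocallyOfFiniteType S.hom := inferInstance
  haveI : IsSeparated S.hom := IsSeparated.of_isAffineHom S.hom
  haveI : IsSeparated 𝒳.hom := by rw [← Over.w f]; infer_instance
  haveI : T2Space (ComplexPoints 𝒳) := ComplexPoints.t2Space_of_isSeparated 𝒳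
  have hp : IsSerreFibration (AlgPoints.map f : ComplexPoints 𝒳 → ComplexPoints S) :=
    isSerreFibration_map_of_smooth_proper f
  -- the topological fibres are the scheme-theoretic fibres
  have he : ∀ s : ComplexPoints S, ∃ e : ComplexPoints (fiberOver f s) ≃ₜ
      ↥((AlgPoints.map f : ComplexPoints 𝒳 → ComplexPoints S) ⁻¹' {s}),
      ∀ x, ((e x : ↥((AlgPoints.map f : ComplexPoints 𝒳 → ComplexPoints S) ⁻¹' {s})) :
        ComplexPoints 𝒳) = AlgPoints.map (fiberι f s) x := fun s => exists_fiberHomeomorph f s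
  choose e he using he
  have hefac : ∀ s, (subsetIncl ((AlgPoints.map f : ComplexPoints 𝒳 → ComplexPoints S) ⁻¹' {s})).comp
      (e s : C(ComplexPoints (fiberOver f s), ↥((AlgPoints.map f : ComplexPoints 𝒳 → ComplexPoints S) ⁻¹' {s}))) =
      AlgPoints.mapContinuous (L := ℂ) (fiberι f s) := fun s => ContinuousMap.ext (he s)
  -- the family on the topological fibres, and its flatness
  let y' : ∀ b : ComplexPoints S,
      singularCohomology ℚ ℚ ↥((AlgPoints.map f : ComplexPoints 𝒳 → ComplexPoints S) ⁻¹' {b}) k :=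
    fun b => singularCohomology.map ℚ ℚ
      ((e b).symm : C(↥((AlgPoints.map f : ComplexPoints 𝒳 → ComplexPoints S) ⁻¹' {b}),
        ComplexPoints (fiberOver f b))) k (y b)
  have hy' : ∀ b₀ : ComplexPoints S, ∃ V ∈ 𝓝 b₀,
      ∃ g : singularCohomology ℚ ℚ ↥((AlgPoints.map f : ComplexPoints 𝒳 → ComplexPoints S) ⁻¹' V) k,
        ∀ (b : ComplexPoints S) (hb : b ∈ V),
          singularCohomology.map ℚ ℚ (subsetInclusion (SerreFlat.fibre_subset_preimage hb)) k g =
            y' b := by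
    intro b₀
    obtain ⟨V, hV, g, hg⟩ := hy b₀
    obtain ⟨e₃, he₃⟩ := exists_tubeHomeomorph f V
    refine ⟨V, hV, singularCohomology.map ℚ ℚ
      (e₃.symm : C(↥((AlgPoints.map f : ComplexPoints 𝒳 → ComplexPoints S) ⁻¹' V), Motives.tube f V)) k g,
      fun b hb => ?_⟩
    have hfac : (e₃.symm : C(↥((AlgPoints.map f : ComplexPoints 𝒳 → ComplexPoints S) ⁻¹' V), Motives.tube f V)).comp
        (subsetInclusion (SerreFlat.fibre_subset_preimage hb)) =
        (Motives.fiberToTube f V b hb).comp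
          ((e b).symm : C(↥((AlgPoints.map f : ComplexPoints 𝒳 → ComplexPoints S) ⁻¹' {b}),
            ComplexPoints (fiberOver f b))) := by
      refine ContinuousMap.ext fun v => Subtype.ext ?_
      have h1 := he₃ (e₃.symm (subsetInclusion (SerreFlat.fibre_subset_preimage hb) v))
      rw [Homeomorph.apply_symm_apply] at h1
      have h2 := he b ((e b).symm v)
      rw [Homeomorph.apply_symm_apply] at h2
      change ((e₃.symm (subsetInclusion (SerreFlat.fibre_subset_preimage hb) v) : Motives.tube f V) :
          ComplexPoints 𝒳) = AlgPoints.map (fiberι f b) ((e b).symm v)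
      rw [← h2, ← h1]
      rfl
    rw [← ModuleCat.comp_apply, ← singularCohomology.map_comp, hfac, singularCohomology.map_comp,
      ModuleCat.comp_apply]
    change _ = singularCohomology.map ℚ ℚ
      ((e b).symm : C(↥((AlgPoints.map f : ComplexPoints 𝒳 → ComplexPoints S) ⁻¹' {b}),
        ComplexPoints (fiberOver f b))) k (y b)
    rw [← hg b hb]
    rfl
  -- Andreotti–Frankel: the exhaustion of `S(ℂ)` by sublevel sets of a proper Morse function of index `≤ 1`
  haveI : SmoothOfRelativeDimension (0 + 1) S.hom := by
    rw [Nat.zero_add]; infer_instance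
  obtain ⟨φ, hφc, -, hφCW⟩ := AffineCoordinates.exists_sublevels_homotopyEquiv_cwComplex_of_isAffine (k := 0) S
  choose a ha hCWa using fun m : ℕ => hφCW (m : ℝ)
  let V : ℕ → Set (ComplexPoints S) := fun m => φ ⁻¹' Iio (m : ℝ)
  let M : ℕ → Set (ComplexPoints S) := fun m => φ ⁻¹' Iic (a m)
  have hVo : ∀ m, IsOpen (V m) := fun m => isOpen_Iio.preimage hφc
  have hVm : Monotone V := fun i j hij => preimage_mono (Iio_subset_Iio (Nat.cast_le.2 hij))
  have hV : ⋃ m, V m = univ := by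
    refine eq_univ_of_forall fun s => mem_iUnion.2 ⟨⌊φ s⌋₊ + 1, ?_⟩
    change φ s < ((⌊φ s⌋₊ + 1 : ℕ) : ℝ)
    push_cast
    exact Nat.lt_floor_add_one (φ s)
  have hVM : ∀ m, V m ⊆ M m := fun m s hs => le_of_lt (lt_trans (mem_Iio.1 hs) (ha m))
  have hCW : ∀ m, ∃ (X : Type) (_ : TopologicalSpace X) (_ : T2Space X)
      (_ : Topology.CWComplex (univ : Set X)),
      (∀ n, 1 < n → IsEmpty (Topology.RelCWComplex.cell (univ : Set X) n)) ∧
        ∃ h : C(X, ↥(M m)), IsWeakHomotopyEquiv h := by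
    intro m
    obtain ⟨C, _, _, _, -, hdim, ⟨ε⟩⟩ := hCWa m
    exact ⟨C, inferInstance, inferInstance, inferInstance, fun n hn => hdim n (by omega), ε.symm.toFun,
      isWeakHomotopyEquiv_homotopyEquiv ε.symm⟩
  -- the topological theorem over the exhausted base
  obtain ⟨z', hz'⟩ := SerreInvariantCycles.exists_class_of_flat_of_exhaustion ℚ hp y' hy' V hVo hVm hV
    M hVM hCW
  refine ⟨z', fun s => ?_⟩
  change singularCohomology.map ℚ ℚ (AlgPoints.mapContinuous (L := ℂ) (fiberι f s)) k z' = y s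
  rw [← hefac s, singularCohomology.map_comp, ModuleCat.comp_apply, hz' s]
  exact SerreFlat.map_homeomorph_map_symm ℚ (e s) k _

/-- **Invariant classes come from the total space over a smooth affine curve** — the sentence of
the named fact `deligne1971_invariantClass_fromTotalSpace_proper` (Deligne, Hodge II,
Thm. 4.1.1 (i): Voisin II Thm. 4.18 for PROPER smooth `f`) for every smooth proper family with
smooth projective fibres over a smooth affine curve, PROVED: every value `σ(s₀)` of a continuous
section `σ` of the espace étalé `FiberClass.pt : FiberClass f k → S(ℂ)` of `Rᵏ f_* ℂ` is the
restriction of a class of the total space, `σ s₀ = globalSection f k β s₀`, `β ∈ Hᵏ(𝒳(ℂ); ℂ)`. The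
reduction of `deligne1968_invariantClass_fromTotalSpace_holds` verbatim (flat coordinate
`ℚ`-sections over the local system `Rᵏ f_* ℂ`, Ehresmann over any smooth base —
`isCohomologicallyLocallyTrivialOn_univ_of_isSmoothProjectiveFamily_of_smooth` —, universal
coefficients `⊗ ℂ` on the compact manifold `𝒳_{s₀}(ℂ)`), run with `invariantCycles_of_affineCurveBase`.
[cite: DeligneHodgeII1971, Théorème 4.1.1 (i)] [cite: VoisinHodgeII2003, Thm. 4.18 and Lemma 4.17]
[cite: HatcherAT2002, §3.1 Thm. 3.2 and §3.A Cor. 3A.4] -/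
theorem invariantClass_fromTotalSpace_of_affineCurveBase {n : ℕ} (hf : IsSmoothProjectiveFamily f n)
    [IsAffine S.left] [SmoothOfRelativeDimension 1 S.hom] (k : ℕ)
    (sec : Motives.ComplexPoints S → FiberClass f k) (hsec : Continuous sec) (hpt : ∀ s, (sec s).pt = s)
    (s₀ : Motives.ComplexPoints S) : ∃ β : complexBetti 𝒳 k, sec s₀ = globalSection f k β s₀ := by
  classical
  haveI : Smooth S.hom := SmoothOfRelativeDimension.smooth 1 _
  haveI : LocallyOfFiniteType S.hom := inferInstance
  haveI : IsProper f.left := hf.isProper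
  have hU := isCohomologicallyLocallyTrivialOn_univ_of_isSmoothProjectiveFamily_of_smooth f hf
  -- the `ℚ`-statement, applied to flat `ℚ`-sections of this family
  have hXf : ∀ y : ∀ s : Motives.ComplexPoints S, Motives.bettiCohomology (Motives.fiberOver f s) k,
      Motives.IsFlatSection f k y → ∃ z : Motives.bettiCohomology 𝒳 k,
        ∀ s, (Motives.bettiCohomology.map (Motives.fiberι f s) k).hom z = y s :=
    fun y hy ↦ invariantCycles_of_affineCurveBase f hf k y hy
  -- the class at `s₀`
  set x : complexBetti (Motives.fiberOver f s₀) k := (sec s₀).clsAt (hpt s₀) with hxdef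
  have hσ₀ : sec s₀ = ⟨s₀, x⟩ := (FiberClass.mk_clsAt _ _).symm
  -- finiteness and universal coefficients on the compact manifold `𝒳_{s₀}(ℂ)`
  have hXs : Motives.IsSmoothProjective n (Motives.fiberOver f s₀) := hf.isSmoothProjective s₀
  haveI : Module.Finite ℚ
      (singularCohomology ℚ ℚ (Motives.ComplexPoints (Motives.fiberOver f s₀)) k) := by
    letI := hXs.chartedSpace
    haveI := Motives.ComplexPoints.compactSpace_of_isSmoothProjective hXs
    haveI := Motives.ComplexPoints.t2Space_of_isSmoothProjective hXs
    exact finite_singularCohomology_of_compact_chartedSpace ℚ ℚ (d := 2 * n) k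
  haveI : Module.Finite ℂ
      (singularCohomology ℂ ℂ (Motives.ComplexPoints (Motives.fiberOver f s₀)) k) := by
    letI := hXs.chartedSpace
    haveI := Motives.ComplexPoints.compactSpace_of_isSmoothProjective hXs
    haveI := Motives.ComplexPoints.t2Space_of_isSmoothProjective hXs
    exact finite_singularCohomology_of_compact_chartedSpace ℂ ℂ (d := 2 * n) k
  have hdim :
      Module.finrank ℂ (singularCohomology ℂ ℂ (Motives.ComplexPoints (Motives.fiberOver f s₀)) k) =
        Module.finrank ℚ
          (singularCohomology ℚ ℚ (Motives.ComplexPoints (Motives.fiberOver f s₀)) k) := by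
    rw [finrank_singularCohomology_eq_bettiNumber_of_field,
      finrank_singularCohomology_eq_bettiNumber_of_field, bettiNumber_eq_of_algebra ℚ ℂ]
  set bL := Module.Basis.ofVectorSpace ℚ ℂ with hbL
  obtain ⟨sJ, hsum⟩ := exists_finset_sum_smul_ringChange_mapCoeff_eq ℚ hdim bL x
  -- flat coordinate sections and their lifts to `Hᵏ(𝒳(ℂ); ℚ)`
  have hflat := fun j ↦ isFlatSection_mapCoeff_clsAt f k hU hsec hpt (bL.coord j)
  choose z hz using fun j ↦ hXf _ (hflat j)
  refine ⟨∑ j ∈ sJ, bL j • singularCohomology.ringChange (algebraMap ℚ ℂ)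
    (Motives.ComplexPoints 𝒳) k (z j), ?_⟩
  rw [hσ₀]
  change (⟨s₀, x⟩ : FiberClass f k) = ⟨s₀, complexBetti.map (Motives.fiberι f s₀) k _⟩
  rw [FiberClass.mk_eq_mk_iff, map_sum, ← hsum]
  refine Finset.sum_congr rfl fun j _ ↦ ?_
  rw [map_smul]
  congr 1
  change _ = singularCohomology.map ℂ ℂ
    (Motives.AlgPoints.mapContinuous (L := ℂ) (Motives.fiberι f s₀)) k
      (singularCohomology.ringChange (algebraMap ℚ ℂ) (Motives.ComplexPoints 𝒳) k (z j))
  rw [← ringChange_map, ← hz j s₀]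

end Family

end Literature.AlgebraicGeometry.HodgeTheory

end
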